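import Summits.QuantumFields.QCD.Theorems.QuarksAsStableActionStableActionBridgeGaugeKernelQuadForm

/-!
# The Fock-valued quadratic form of the Wilson pure-gauge transfer kernel is nonnegative
(crux `QuarksAsStableAction.StableActionBridge`, item stmt-QuantumFields-9737, line `Sketch`;
registered stub `gaugeSliceKernel_quadForm_dotProduct_nonneg` of the lead skeleton)

In temporal gauge the one-step transfer operator of lattice QCD acts on wave functions
`Ψ : SU(3)^{links} → Fock` of the spatial link variables with values in the quark Fock space, and
its gauge part is the integral operator with the Wilson kernel
`K_β(U, U') = e^{−(β/2)S₃(U)} exp(−β∑ₗ(3 − Re tr(U_l U'_lᴴ))) e^{−(β/2)S₃(U')}` (`gaugeSliceKernel`;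
Smit, *Introduction to Quantum Fields on a Lattice*, §4.6 (4.121)–(4.129); Lüscher, CMP 54 (1977)).
The full transfer form is `∫∫ K_β(U, U') ⟨χ(U), χ(U')⟩_Fock dμ dμ` with `χ = T̂_F Ψ`
(`transferForm`), `⟨u, v⟩_Fock = star u ⬝ᵥ v`.

We prove the vector-valued upgrade of the scalar positivity `gaugeSliceKernel_quadForm_nonneg`:
for `β ≥ 0`, a finite measure `μ` on the link configurations and a bounded family
`χ : SU(3)^{links} → (ι → ℂ)` (`ι` finite) with measurable components,

  `Re ∫∫ K_β(U, U') (star (χ U) ⬝ᵥ χ U') dμ(U') dμ(U) ≥ 0`,  `Im (…) = 0`.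

Proof: `star (χ U) ⬝ᵥ χ U' = ∑ᵢ conj (χ U i) χ U' i`; every summand
`conj (χ U i) K_β(U, U') χ U' i` is bounded and jointly measurable (the kernel is continuous on the
compact configuration space, hence bounded and Borel), so the finite sum comes out of both Bochner
integrals (Fubini for the outer one), and each term is the scalar quadratic form of the component
`U ↦ χ U i`, nonnegative with zero imaginary part by `gaugeSliceKernel_quadForm_nonneg`.
[cite: Luscher1977, pp. 283–292] [cite: Smit2023, §4.6 (4.121)–(4.129)]
-/

noncomputable section

open MeasureTheory Matrix Literature.MathematicalPhysics.QuantumFieldTheory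
  Literature.MathematicalPhysics.QuantumLattice
open scoped ComplexOrder

namespace Summit.QuantumFields.QCD.Cruxes.StableActionBridge.Sketch

/-- **Finite sums out of a vector-valued quadratic form.** On a finite measure space, for a
bounded jointly measurable real kernel `K` and a bounded family `χ : X → (ι → ℂ)` (`ι` finite)
with measurable components,
`∫∫ K(x, y) (star (χ x) ⬝ᵥ χ y) = ∑ᵢ ∫∫ conj (χ x i) K(x, y) χ y i`: every summand is bounded and
measurable, hence integrable on `μ ⊗ μ` and along every section, so the sum commutes with the
inner integral termwise and with the outer one by Fubini (`Integrable.integral_prod_left`).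
[folklore] -/
private theorem quadForm_dotProduct_eq_sum {X : Type} [MeasurableSpace X] (μ : Measure X)
    [IsFiniteMeasure μ] {ι : Type} [Fintype ι] (K : X → X → ℝ) (χ : X → ι → ℂ) (B C : ℝ)
    (hKm : Measurable fun p : X × X => K p.1 p.2) (hKb : ∀ x y, |K x y| ≤ B)
    (hχb : ∀ x i, ‖χ x i‖ ≤ C) (hχm : ∀ i, Measurable fun x => χ x i) :
    ∫ x, ∫ y, ((K x y : ℝ) : ℂ) * (star (χ x) ⬝ᵥ χ y) ∂μ ∂μ =
      ∑ i, ∫ x, ∫ y, (starRingEnd ℂ) (χ x i) * ((K x y : ℝ) : ℂ) * χ y i ∂μ ∂μ := by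
  -- the summands: a uniform bound and joint measurability
  have hb : ∀ (i : ι) (x y : X),
      ‖(starRingEnd ℂ) (χ x i) * ((K x y : ℝ) : ℂ) * χ y i‖ ≤ C * B * C := fun i x y => by
    rw [norm_mul, norm_mul, Complex.norm_conj, Complex.norm_real, Real.norm_eq_abs]
    have hC : 0 ≤ C := (norm_nonneg _).trans (hχb x i)
    exact mul_le_mul (mul_le_mul (hχb x i) (hKb x y) (abs_nonneg _) hC) (hχb y i) (norm_nonneg _)
      (mul_nonneg hC ((abs_nonneg _).trans (hKb x y)))
  have hm : ∀ i : ι, Measurable fun p : X × X =>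
      (starRingEnd ℂ) (χ p.1 i) * ((K p.1 p.2 : ℝ) : ℂ) * χ p.2 i := fun i =>
    ((Complex.continuous_conj.measurable.comp ((hχm i).comp measurable_fst)).mul
      hKm.complex_ofReal).mul ((hχm i).comp measurable_snd)
  -- integrability on the product space and along every section
  have hI : ∀ i : ι, Integrable (fun p : X × X =>
      (starRingEnd ℂ) (χ p.1 i) * ((K p.1 p.2 : ℝ) : ℂ) * χ p.2 i) (μ.prod μ) := fun i =>
    Integrable.of_bound (hm i).aestronglyMeasurable (C * B * C)
      (Filter.Eventually.of_forall fun p => hb i p.1 p.2)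
  have hIy : ∀ (i : ι) (x : X), Integrable (fun y : X =>
      (starRingEnd ℂ) (χ x i) * ((K x y : ℝ) : ℂ) * χ y i) μ := fun i x =>
    Integrable.of_bound ((hm i).comp measurable_prodMk_left).aestronglyMeasurable (C * B * C)
      (Filter.Eventually.of_forall fun y => hb i x y)
  -- the inner integral: expand the dot product and take the finite sum out
  have hin : ∀ x : X, ∫ y, ((K x y : ℝ) : ℂ) * (star (χ x) ⬝ᵥ χ y) ∂μ =
      ∑ i, ∫ y, (starRingEnd ℂ) (χ x i) * ((K x y : ℝ) : ℂ) * χ y i ∂μ := fun x => by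
    have e : (fun y => ((K x y : ℝ) : ℂ) * (star (χ x) ⬝ᵥ χ y)) =
        fun y => ∑ i, (starRingEnd ℂ) (χ x i) * ((K x y : ℝ) : ℂ) * χ y i := by
      funext y
      simp only [dotProduct, Pi.star_apply, Complex.star_def, Finset.mul_sum]
      exact Finset.sum_congr rfl fun i _ => by ring
    rw [e]
    exact integral_finsetSum _ fun i _ => hIy i x
  -- the outer integral: Fubini
  calc ∫ x, ∫ y, ((K x y : ℝ) : ℂ) * (star (χ x) ⬝ᵥ χ y) ∂μ ∂μ
      = ∫ x, ∑ i, ∫ y, (starRingEnd ℂ) (χ x i) * ((K x y : ℝ) : ℂ) * χ y i ∂μ ∂μ :=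
        integral_congr_ae (Filter.Eventually.of_forall hin)
    _ = ∑ i, ∫ x, ∫ y, (starRingEnd ℂ) (χ x i) * ((K x y : ℝ) : ℂ) * χ y i ∂μ ∂μ :=
        integral_finsetSum _ fun i _ => (hI i).integral_prod_left

/-- The Wilson transfer kernel `K_β` is jointly continuous on the (compact) space of pairs of
`SU(3)` link configurations: it is built from finitely many matrix entries by products, sums,
traces, real parts and exponentials. [folklore] -/
private theorem continuous_gaugeSliceKernel_prod (S : ℕ) [NeZero S] (β : ℝ) :
    Continuous fun p : GaugeConfig 3 S (Matrix.specialUnitaryGroup (Fin 3) ℂ) ×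
        GaugeConfig 3 S (Matrix.specialUnitaryGroup (Fin 3) ℂ) => gaugeSliceKernel β p.1 p.2 := by
  have hρ := continuous_fundamentalRep (Fin 3)
  have hW : Continuous fun U : GaugeConfig 3 S (Matrix.specialUnitaryGroup (Fin 3) ℂ) =>
      wilsonAction (fundamentalRep (Fin 3)) U := by
    unfold wilsonAction plaquetteHolonomy
    fun_prop
  unfold gaugeSliceKernel
  fun_prop

/-- The Wilson transfer kernel is bounded in absolute value, uniformly in both configurations
(a continuous function on a compact space; `K_β > 0`). [folklore] -/
private theorem exists_abs_gaugeSliceKernel_le (S : ℕ) [NeZero S] (β : ℝ) :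
    ∃ B : ℝ, ∀ U U' : GaugeConfig 3 S (Matrix.specialUnitaryGroup (Fin 3) ℂ),
      |gaugeSliceKernel β U U'| ≤ B := by
  obtain ⟨B, hB⟩ := (isCompact_range (continuous_gaugeSliceKernel_prod S β)).bddAbove
  exact ⟨B, fun U U' =>
    (abs_of_pos (gaugeSliceKernel_pos β U U')).trans_le (hB ⟨(U, U'), rfl⟩)⟩

/-- **Nonnegativity of the Fock-valued quadratic form of the Wilson pure-gauge transfer kernel**
(`⟨χ, (T̂_U ⊗ 1) χ⟩ ≥ 0` on `L²(SU(3)^{links}, μ) ⊗ ℂ^ι`, the gauge half of the Lüscher /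
Osterwalder–Seiler positivity of the transfer operator at the level of forms, vector-valued
version).  For `β ≥ 0`, a finite measure `μ` on the `SU(3)` link configurations of the spatial
three-torus, a finite index type `ι` and a bounded family `χ : U ↦ (ι → ℂ)` with measurable
components, `Re ∫∫ K_β(U, U') (star (χ U) ⬝ᵥ χ U') dμ(U') dμ(U) ≥ 0` and `Im (…) = 0`.
Proof: the double integral is `∑ᵢ ∫∫ conj (χ U i) K_β(U, U') χ U' i`
(`quadForm_dotProduct_eq_sum`; the kernel is continuous on a compact space, hence bounded and
jointly measurable), and each term is handled by the scalar statement
`gaugeSliceKernel_quadForm_nonneg`. [cite: Smit2023, §4.6 (4.121)–(4.129)] -/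
theorem gaugeSliceKernel_quadForm_dotProduct_nonneg : ∀ (S : ℕ) [NeZero S] (β : ℝ), 0 ≤ β → ∀ (ι : Type) [Fintype ι] (μ : Measure (GaugeConfig 3 S (Matrix.specialUnitaryGroup (Fin 3) ℂ))) [IsFiniteMeasure μ] (χ : GaugeConfig 3 S (Matrix.specialUnitaryGroup (Fin 3) ℂ) → ι → ℂ), (∃ C : ℝ, ∀ U i, ‖χ U i‖ ≤ C) → (∀ i, Measurable fun U => χ U i) → 0 ≤ (∫ U, ∫ U', ((gaugeSliceKernel β U U' : ℝ) : ℂ) * (star (χ U) ⬝ᵥ χ U') ∂μ ∂μ).re ∧ (∫ U, ∫ U', ((gaugeSliceKernel β U U' : ℝ) : ℂ) * (star (χ U) ⬝ᵥ χ U') ∂μ ∂μ).im = 0 := by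
  intro S _ β hβ ι _ μ _ χ hχb hχm
  obtain ⟨C, hC⟩ := hχb
  obtain ⟨B, hB⟩ := exists_abs_gaugeSliceKernel_le S β
  rw [quadForm_dotProduct_eq_sum μ (gaugeSliceKernel β) χ B C
    (continuous_gaugeSliceKernel_prod S β).measurable hB hC hχm, Complex.re_sum, Complex.im_sum]
  have h := fun i : ι =>
    gaugeSliceKernel_quadForm_nonneg S β hβ μ (fun U => χ U i) ⟨C, fun U => hC U i⟩ (hχm i)
  exact ⟨Finset.sum_nonneg fun i _ => (h i).1, Finset.sum_eq_zero fun i _ => (h i).2⟩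

end Summit.QuantumFields.QCD.Cruxes.StableActionBridge.Sketch

end
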